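import Literature.Computability.MetaComplexity.SearchHeuristicSchemesProofs
import Literature.Computability.MetaComplexity.LanguageCompressionHardE
import Literature.Computability.MetaComplexity.WeakSymmetryOfInformation
import HarnessLib

/-!
# Complexity meta: Hirahara 2021, Thm. 8.9 (`UP` form) relative to ONE leaf — a `2^{εn}`-hard language in `E`

Topic `Literature/Computability/MetaComplexity`, third proof file of the named fact
`Hirahara2021_UP_searchUHS_of_Avg1P` (S. Hirahara, *Average-case hardness of NP from exponential
worst-case hardness assumptions*, ECCC TR21-058 / STOC 2021, Thm. 8.9 for `UP`-type verifiers).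
`SearchHeuristicSchemesProofs.lean` reduced the fact to three leaves — Thm. 4.2 (`h42`, the named fact
`Hirahara2021_languageCompression`), Lemma 3.4 in promise form (`h34`: the hypothesis gives
`pr-BPP = pr-P`) and Thm. 5.2 (`h52`, weak symmetry of information). Since then the tree has proved

* Thm. 5.2 from a quick pseudorandom generator and Lemma 5.1
  (`Hirahara2021_weakSOI_of_PRG`, `WeakSymmetryOfInformation.lean`);
* Thm. 4.2 from a single hypothesis — a language in `E` of circuit complexity `≥ 2^{εn}` at all large
  `n` under Hirahara's hypothesis (`Hirahara2021_languageCompression_of_hardE`,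
  `LanguageCompressionHardE.lean`), i.e. items 1–3 of the proof sketch of Lemma 3.4 (p. 20), item 4
  (Impagliazzo–Wigderson) and the generator being theorems (`exists_avgHard_E_of_hard_E`,
  `exists_isSizePseudorandom_of_avgHard_E`, `PromiseBPP'_subset_PromiseP_of_avgHard_E`);
* Lemma 5.1 from Thm. 4.2 (`Hirahara2021_gapKvsK_mem_PromiseP_of_languageCompression`).

Hence Thm. 8.9 (`UP`) itself depends on exactly that one leaf:

* **`Hirahara2021_UP_searchUHS_of_Avg1P_of_hardE`** — the named fact from
  *`coNP × {U, T} ⊆ Avg¹_{1-n^{-c}}P` (some `c`) implies `E ⊄ i.o.SIZE(2^{εn})` for some `ε > 0`*;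
* **`Hirahara2021_UP_searchUHS_of_Avg1P_of_lemma37`** — and, item 1 of the sketch being a theorem
  (`Hirahara2021_exists_NTIME_two_pow_subset_DTIME_of_Avg1P`, `AvgCaseTallyNE.lean`) together with
  the almost-everywhere diagonal language, from exactly **Buhrman–Fortnow–Pavan's Lemma 3.7 under
  Hirahara's hypothesis** ("if for all `ε > 0`, `E` infinitely often has circuits of size `2^{εn}`,
  then for all `A ∈ E` there is `B ∈ NTIME(2ⁿ)` with `Aₙ = Bₙ` for infinitely many `n`";
  `Hirahara2021_hardE_of_lemma37`) — whose printed proof is probabilistically checkable proofs for `E`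
  turned into Merlin–Arthur protocols by the small circuits and derandomised by `pr-MA = pr-NP`
  (item 2 of the sketch, [KS04]; proved in the tree's `AvgCaseMADerandomization.lean` line of files)
  — the one ingredient (the PCP step) the tree lacks; the same leaf as `Hirahara2021_languageCompression`
  and as the named fact `BuhrmanFortnowPavan2004_PromiseBPP'_subset_PromiseP`.

The corresponding forms of Cor. 8.12 for `UP` are recorded too. No new named facts (D-0026).

## References

* S. Hirahara, ECCC TR21-058 (2021): Thm. 8.9 and its proof (pp. 40–42), Cor. 8.12, Lemma 3.4
  (p. 20, proof sketch items 1–4), Thm. 4.2, Lemma 5.1, Thm. 5.2 [Hirahara2021].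
* H. Buhrman, L. Fortnow, A. Pavan, *Some results on derandomization*, Theory Comput. Syst. 38 (2005),
  Thm. 3.1 (proof), Lemma 3.7 [BuhrmanFortnowPavan2004].
* R. Impagliazzo, A. Wigderson, STOC 1997, Thms. 1–2 [ImpagliazzoWigderson1997].
-/

namespace Literature.Computability.MetaComplexity

open _root_.Computability Polynomial Complexity Complexity.Classes Complexity.Nondeterministic Filter

/-- **Hirahara 2021, Thm. 8.9 (`UP` form), relative to a `2^{εn}`-hard language in `E`.** If Hirahara's
hypothesis `coNP × {U, T} ⊆ Avg¹_{1-n^{-c}}P` yields some `L ∈ E` and `ε > 0` with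
`circuitSize(L, n) ≥ 2^{εn}` for all large `n` (items 1–3 of the proof sketch of Lemma 3.4), then the
named fact `Hirahara2021_UP_searchUHS_of_Avg1P` holds: the three leaves of
`Hirahara2021_UP_searchUHS_of_Avg1P_of_leaves` are Thm. 4.2 (`Hirahara2021_languageCompression_of_hardE`),
`pr-BPP = pr-P` (Impagliazzo–Wigderson amplification, the quick Nisan–Wigderson generator and Arora–Barak
Lemma 20.3 in promise form) and Thm. 5.2 (`Hirahara2021_weakSOI_of_PRG` with Lemma 5.1 from Thm. 4.2).
[Hirahara 2021 (ECCC TR21-058), Thm. 8.9 (proof), Lemma 3.4 (proof sketch), Lemma 5.1, Thm. 5.2]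
[cite: Hirahara2021, Thm. 8.9 (proof, pp. 40–42) and Lemma 3.4 (proof sketch, p. 20)] -/
theorem Hirahara2021_UP_searchUHS_of_Avg1P_of_hardE
    (hE : (∃ c : ℕ, distClass coNP {uniformEnsemble, tallyEnsemble} ⊆ Avg1DeltaP fun n => 1 - 1 / (n : ℝ) ^ c) →
      ∃ L ∈ E, ∃ ε : ℝ, 0 < ε ∧ ∀ᶠ n : ℕ in atTop, (2 : ℝ) ^ (ε * n) ≤ (L.circuitSize n : ℝ)) :
    Hirahara2021_UP_searchUHS_of_Avg1P := by
  have h42 : Hirahara2021_languageCompression := Hirahara2021_languageCompression_of_hardE hE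
  refine Hirahara2021_UP_searchUHS_of_Avg1P_of_leaves h42 (fun hyp => ?_) (fun U hyp => ?_)
  · obtain ⟨L', hL', ε', hε', hhard⟩ := exists_avgHard_E_of_hard_E (hE hyp)
    exact PromiseBPP'_subset_PromiseP_of_avgHard_E hL' hε' hhard
  · obtain ⟨L', hL', ε', hε', hhard⟩ := exists_avgHard_E_of_hard_E (hE hyp)
    exact Hirahara2021_weakSOI_of_PRG U (exists_isSizePseudorandom_of_avgHard_E hL' hε' hhard)
      (Hirahara2021_gapKvsK_mem_PromiseP_of_languageCompression h42 U hyp)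

/-- **Hirahara 2021, Thm. 8.9 (`UP` form), relative to Buhrman–Fortnow–Pavan's Lemma 3.7 under
Hirahara's hypothesis** (the weakest form consumed: `B ∈ NTIME(2ⁿ)` agreeing with `A` at infinitely
many lengths, whenever every language in `E` has `2^{εn}`-size circuits infinitely often for every
`ε > 0`): with item 1 of the proof sketch of Lemma 3.4 (`NE = E` in the [IKW02] form,
`Hirahara2021_exists_NTIME_two_pow_subset_DTIME_of_Avg1P`) and the almost-everywhere diagonal language,
BFP's proof of item 3 gives the hard language in `E` (`Hirahara2021_hardE_of_lemma37`), and the previous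
theorem applies. [Hirahara 2021 (ECCC TR21-058), Thm. 8.9, Lemma 3.4 (proof sketch, items 1–4);
Buhrman–Fortnow–Pavan 2005, Thm. 3.1 (proof), Lemma 3.7]
[cite: Hirahara2021, Thm. 8.9 and Lemma 3.4 (proof sketch, p. 20)] [cite: BuhrmanFortnowPavan2004, Lemma 3.7] -/
theorem Hirahara2021_UP_searchUHS_of_Avg1P_of_lemma37
    (h37 : (∃ c : ℕ, distClass coNP {uniformEnsemble, tallyEnsemble} ⊆ Avg1DeltaP fun n => 1 - 1 / (n : ℝ) ^ c) →
      (∀ A ∈ E, ∀ ε : ℝ, 0 < ε → ∃ᶠ n : ℕ in atTop, (A.circuitSize n : ℝ) ≤ (2 : ℝ) ^ (ε * n)) →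
      ∀ A ∈ E, ∃ B ∈ NTIME (fun n => 2 ^ n), ∃ᶠ n : ℕ in atTop,
        ∀ x : List Bool, x.length = n → (x ∈ A ↔ x ∈ B)) :
    Hirahara2021_UP_searchUHS_of_Avg1P :=
  Hirahara2021_UP_searchUHS_of_Avg1P_of_hardE fun hyp => Hirahara2021_hardE_of_lemma37 hyp (h37 hyp)

/-- **Cor. 8.12 for `UP`, relative to a `2^{εn}`-hard language in `E`** (every `L ∈ UP` admits a
universal heuristic scheme under Hirahara's hypothesis). [cite: Hirahara2021, Cor. 8.12 and Thm. 8.9] -/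
theorem Hirahara2021_UP_hasUHS_of_Avg1P_of_hardE
    (hE : (∃ c : ℕ, distClass coNP {uniformEnsemble, tallyEnsemble} ⊆ Avg1DeltaP fun n => 1 - 1 / (n : ℝ) ^ c) →
      ∃ L ∈ E, ∃ ε : ℝ, 0 < ε ∧ ∀ᶠ n : ℕ in atTop, (2 : ℝ) ^ (ε * n) ≤ (L.circuitSize n : ℝ)) :
    ∀ U : UniversalMachine,
      (∃ c : ℕ, distClass coNP {uniformEnsemble, tallyEnsemble} ⊆
        Avg1DeltaP fun n => 1 - 1 / (n : ℝ) ^ c) →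
      ∀ L ∈ UP, U.HasUniversalHeuristicScheme L :=
  Hirahara2021_UP_hasUHS_of_Avg1P_of_search (Hirahara2021_UP_searchUHS_of_Avg1P_of_hardE hE)

/-- **Cor. 8.12 for `UP`, relative to Buhrman–Fortnow–Pavan's Lemma 3.7 under Hirahara's hypothesis.**
[cite: Hirahara2021, Cor. 8.12 and Thm. 8.9] [cite: BuhrmanFortnowPavan2004, Lemma 3.7] -/
theorem Hirahara2021_UP_hasUHS_of_Avg1P_of_lemma37
    (h37 : (∃ c : ℕ, distClass coNP {uniformEnsemble, tallyEnsemble} ⊆ Avg1DeltaP fun n => 1 - 1 / (n : ℝ) ^ c) →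
      (∀ A ∈ E, ∀ ε : ℝ, 0 < ε → ∃ᶠ n : ℕ in atTop, (A.circuitSize n : ℝ) ≤ (2 : ℝ) ^ (ε * n)) →
      ∀ A ∈ E, ∃ B ∈ NTIME (fun n => 2 ^ n), ∃ᶠ n : ℕ in atTop,
        ∀ x : List Bool, x.length = n → (x ∈ A ↔ x ∈ B)) :
    ∀ U : UniversalMachine,
      (∃ c : ℕ, distClass coNP {uniformEnsemble, tallyEnsemble} ⊆
        Avg1DeltaP fun n => 1 - 1 / (n : ℝ) ^ c) →
      ∀ L ∈ UP, U.HasUniversalHeuristicScheme L :=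
  Hirahara2021_UP_hasUHS_of_Avg1P_of_search (Hirahara2021_UP_searchUHS_of_Avg1P_of_lemma37 h37)

end Literature.Computability.MetaComplexity
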